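import Literature.NumberTheory.IwasawaTheory.FukudaElementaryLayerGenerator
import HarnessLib

/-!
# The RELATION lemma over `ℤ[φ]` acting on a finite abelian `p`-group: ONE relation `(φ−1)^d·u(φ)·x₀ ∈ pM` (`p ∤ u(1)`) on a GENERATOR
# `x₀` (`x₀ ∉ 𝔪M = pM + (φ−1)M`, `#(M/𝔪M) ≤ p`) forces `#(M/pM) ≤ p^d`

Topic `NumberTheory/IwasawaTheory` (namespace `Literature.NumberTheory.IwasawaTheory.FukudaRelation`).  THEOREM-ONLY file (no definition, no named
fact, no instance, no `sorry`), written by the prover seat `bsd-line-att-p3` g48 (cell `bsd-f1-sign2`, route `AlignedTransportAtTwo`; `--supports`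
stmt-BirchSwinnertonDyer-22298, closes nothing; BSD is not advanced by this file).  Algebra brick behind the RELATION DOOR
(`ClassGroupPRankLeOfRelation`): it re-uses this seat's g47 bricks `FukudaElementaryLayerNakayama` (units `f(φ)` with `p ∤ f(1)`, Nakayama) and
`FukudaElementaryLayerGenerator` (the filtration count).

THE SETTING (Washington §13.3 read at finite level).  `M` a finite abelian group of `p`-power order (a layer `A_n = X/ν_n X` of a CYCLIC Iwasawa module
`X = Λ/J`), `φ ∈ End_ℤ(M)` with `φ^{p^t} = 1` (the generator of `Gal(K_n/K)`), `T = φ − 1`, `𝔪M = pM + TM`.  If `#(M/𝔪M) ≤ p` then ANY `x₀ ∉ 𝔪M` generates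
`M` over `ℤ[φ]` (Nakayama), so `Ann(x₀) = Ann(M)` (`= J + ν_nΛ`); a relation `F(φ)x₀ = 0` with `F = (X−1)^d·u + p·g`, `p ∤ u(1)` — i.e. `F mod p` of
ORDER `d` at `X = 1` — gives `T^d M ⊆ pM` (`u(φ)` is a unit), hence `#(M/pM) ≤ #(M/𝔪M)^d ≤ p^d`: the `p`-RANK of `M` is at most `d`.  In `Λ`-terms:
`J + ν_nΛ ∋ F ∉ (p, T^{d+1})`, so `J ⊄ pΛ` as soon as `d < p^n − 1` — `μ = 0` (door L10 downstream).

* `forall_exists_aeval_apply_eq_of_not_mem` — `#(M/𝔪M) ≤ p`, `x₀ ∉ 𝔪M` ⟹ **`M = ℤ[φ]·x₀`**.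
* `range_pow_le_of_relation` — `M = ℤ[φ]·x₀`, `p ∤ u(1)`, `(φ−1)^d (u(φ) x₀) ∈ pM` ⟹ **`(φ−1)^d M ⊆ pM`**.
* ★★ `card_quotient_smul_le_pow_of_relation` — `#(M/𝔪M) ≤ p`, `x₀ ∉ 𝔪M`, `p ∤ u(1)`, `(φ−1)^d (u(φ) x₀) ∈ pM` ⟹ **`#(M/pM) ≤ p^d`**.
* ★★ `card_quotient_smul_le_pow_of_sum_smul_pow_apply_eq_zero` — the same with the relation handed over as a COEFFICIENT VECTOR:
  `∑_{i<N} f_i·φ^i x₀ = 0` and the polynomial identity `∑_{i<N} f_i X^i = (X−1)^d·u + p·g` in `ℤ[X]`.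

References: [Washington1997] L. Washington, *Introduction to Cyclotomic Fields*, 2nd ed., §13.2 Lemma 13.16 (Nakayama), §13.3 Lemmas 13.15, 13.18,
Prop. 13.22–13.23; [Fukuda1994] T. Fukuda, *Remarks on ℤ_p-extensions of number fields*, Proc. Japan Acad. 70 A (1994), Thm. 1 and its proof, p. 264;
[Lang1990] S. Lang, *Cyclotomic Fields I and II*, Ch. 5 §1–§2 (the local ring `Λ`, Weierstrass degree).
-/

set_option autoImplicit false

noncomputable section

open Polynomial Finset

namespace Literature.NumberTheory.IwasawaTheory.FukudaRelation

open Literature.NumberTheory.IwasawaTheory.FukudaElementary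

section Module

variable {M : Type*} [AddCommGroup M] {p : ℕ}

/-! ## §1 A generator from ONE element outside `𝔪M` -/

/-- **`M = ℤ[φ]·x₀`** for any `x₀ ∉ 𝔪M = pM + (φ−1)M`, when `#(M/𝔪M) ≤ p` (`M` a finite abelian `p`-group, `φ^{p^t} = 1`): `M/𝔪M` is cyclic of order `p`
generated by the class of `x₀`, so `M = ℤx₀ + 𝔪M`, and Nakayama over `ℤ[φ]`. [cite: Washington1997, §13.2 Lemma 13.16, §13.3 Lemma 13.15]
[cite: Fukuda1994, Thm. 1 (proof, p. 264)] -/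
theorem forall_exists_aeval_apply_eq_of_not_mem [Finite M] [hp : Fact p.Prime] (hM : ∃ a : ℕ, Nat.card M = p ^ a) (φ : Module.End ℤ M)
    {t : ℕ} (hφ : φ ^ p ^ t = 1)
    (hQ : Nat.card (M ⧸ ((⊤ : Submodule ℤ M).map ((p : ℤ) • (1 : Module.End ℤ M)) ⊔ (⊤ : Submodule ℤ M).map (φ - 1))) ≤ p)
    {x₀ : M} (hx₀ : x₀ ∉ (⊤ : Submodule ℤ M).map ((p : ℤ) • (1 : Module.End ℤ M)) ⊔ (⊤ : Submodule ℤ M).map (φ - 1)) :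
    ∀ y : M, ∃ f : ℤ[X], aeval φ f x₀ = y := by
  classical
  obtain ⟨a, ha⟩ := hM
  set π : Module.End ℤ M := (p : ℤ) • 1 with hπ
  set T : Module.End ℤ M := φ - 1 with hT
  set Q : Submodule ℤ M := (⊤ : Submodule ℤ M).map π ⊔ (⊤ : Submodule ℤ M).map T with hQdef
  -- the evaluation map at `x₀` and its range `ℤ[φ]·x₀`
  have hrange : ∃ R₀ : Submodule ℤ M, (∀ y, y ∈ R₀ ↔ ∃ f : ℤ[X], aeval φ f x₀ = y) ∧ (∀ y ∈ R₀, φ y ∈ R₀) := by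
    let ev : ℤ[X] →ₗ[ℤ] M := (LinearMap.applyₗ x₀).comp (aeval φ : ℤ[X] →ₐ[ℤ] Module.End ℤ M).toLinearMap
    have hev : ∀ f, ev f = aeval φ f x₀ := fun f => rfl
    refine ⟨LinearMap.range ev, fun y => ?_, ?_⟩
    · rw [LinearMap.mem_range]
      exact ⟨fun ⟨f, hf⟩ => ⟨f, by rw [← hev]; exact hf⟩, fun ⟨f, hf⟩ => ⟨f, by rw [hev]; exact hf⟩⟩
    · rintro _ ⟨f, rfl⟩
      refine ⟨X * f, ?_⟩
      rw [hev, hev, map_mul, aeval_X, Module.End.mul_apply]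
  -- `#(M/Q) = p`, and `x₀` generates `M/Q`
  haveI : Finite (M ⧸ Q) := Finite.of_surjective _ (Submodule.Quotient.mk_surjective _)
  have hcardQ : Nat.card (M ⧸ Q) = p := by
    have hdvd : Nat.card (M ⧸ Q) ∣ p ^ a := by
      rw [← ha, Submodule.card_eq_card_quotient_mul_card Q]; exact Dvd.intro_left _ rfl
    obtain ⟨b, hb, hbeq⟩ := (Nat.dvd_prime_pow hp.out).mp hdvd
    rcases b with _ | b
    · exfalso
      rw [pow_zero] at hbeq
      have hsub : Subsingleton (M ⧸ Q) := (Nat.card_eq_one_iff_unique.mp hbeq).1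
      exact hx₀ ((Submodule.Quotient.mk_eq_zero Q).mp (Subsingleton.elim _ _))
    · rw [hbeq] at hQ ⊢
      have hb0 : b = 0 := by
        by_contra hb0
        have : p ^ 2 ≤ p ^ (b + 1) := Nat.pow_le_pow_right hp.out.pos (by omega)
        have hp2 : p < p ^ 2 := by
          calc p = p ^ 1 := (pow_one p).symm
            _ < p ^ 2 := Nat.pow_lt_pow_right hp.out.one_lt (by norm_num)
        omega
      rw [hb0, zero_add, pow_one]
  have hgenQ : ∀ y : M, ∃ n : ℤ, y - n • x₀ ∈ Q := by
    intro y
    have hxbar : Q.mkQ x₀ ≠ 0 := fun h => hx₀ ((Submodule.Quotient.mk_eq_zero Q).mp h)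
    have hord : addOrderOf (Q.mkQ x₀) = p := by
      have hdvd : addOrderOf (Q.mkQ x₀) ∣ p := by
        rw [← hcardQ]; exact addOrderOf_dvd_natCard _
      rcases (Nat.dvd_prime hp.out).mp hdvd with h | h
      · exact absurd (AddMonoid.addOrderOf_eq_one_iff.mp h) hxbar
      · exact h
    have htop : AddSubgroup.zmultiples (Q.mkQ x₀) = ⊤ := by
      apply AddSubgroup.eq_top_of_card_eq
      rw [Nat.card_zmultiples, hord, hcardQ]
    have hy : Q.mkQ y ∈ AddSubgroup.zmultiples (Q.mkQ x₀) := by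
      rw [htop]; exact AddSubgroup.mem_top _
    obtain ⟨n, hn⟩ := AddSubgroup.mem_zmultiples_iff.mp hy
    refine ⟨n, ?_⟩
    rw [← Submodule.ker_mkQ Q, LinearMap.mem_ker, map_sub, map_zsmul, ← hn, sub_self]
  obtain ⟨R₀, hR₀, hR₀φ⟩ := hrange
  have htop : (⊤ : Submodule ℤ M) ≤ R₀ ⊔ ((⊤ : Submodule ℤ M).map π ⊔ (⊤ : Submodule ℤ M).map T) := by
    intro y _
    obtain ⟨n, hn⟩ := hgenQ y
    have hy : y = n • x₀ + (y - n • x₀) := by abel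
    rw [hy]
    refine Submodule.add_mem_sup ((hR₀ _).mpr ⟨C n, ?_⟩) hn
    rw [aeval_C, algebraMap_int_eq, eq_intCast, Module.End.intCast_apply]
  have hMR₀ : (⊤ : Submodule ℤ M) ≤ R₀ :=
    le_of_le_sup_smul_sup_sub_one ⟨a, ha⟩ φ hφ (fun _ _ => Submodule.mem_top) hR₀φ htop
  exact fun y => (hR₀ y).mp (hMR₀ Submodule.mem_top)

/-! ## §2 The relation bounds the `p`-rank -/

/-- **`(φ−1)^d M ⊆ pM`** when `M = ℤ[φ]·x₀`, `p ∤ u(1)` and `(φ−1)^d (u(φ) x₀) ∈ pM`: `u(φ)` is a unit commuting with `φ` (tree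
`isUnit_aeval_of_not_dvd_eval`), so `(φ−1)^d x₀ = u(φ)⁻¹ (φ−1)^d u(φ) x₀ ∈ pM`, and `(φ−1)^d f(φ) x₀ = f(φ) (φ−1)^d x₀ ∈ pM` for every `f`.
[cite: Washington1997, §13.2 Lemma 13.16, §13.3 Prop. 13.22 (proof)] -/
theorem range_pow_le_of_relation [Finite M] [hp : Fact p.Prime] (hM : ∃ a : ℕ, Nat.card M = p ^ a) (φ : Module.End ℤ M) {t : ℕ}
    (hφ : φ ^ p ^ t = 1) {x₀ : M} (hgen : ∀ y : M, ∃ f : ℤ[X], aeval φ f x₀ = y) {u : ℤ[X]} (hu : ¬ (p : ℤ) ∣ u.eval 1) {d : ℕ}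
    (hrel : ((φ - 1) ^ d) (aeval φ u x₀) ∈ (⊤ : Submodule ℤ M).map ((p : ℤ) • (1 : Module.End ℤ M))) :
    LinearMap.range ((φ - 1) ^ d) ≤ (⊤ : Submodule ℤ M).map ((p : ℤ) • (1 : Module.End ℤ M)) := by
  obtain ⟨w, hw⟩ := isUnit_aeval_of_not_dvd_eval hM φ hφ hu
  -- `(φ−1)^d` commutes with every polynomial in `φ`
  have hcomm : ∀ f : ℤ[X], Commute ((φ - 1) ^ d) (aeval φ f) := fun f =>
    (commute_aeval_of_commute (commute_sub_one_self φ) f).pow_left d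
  -- `(φ−1)^d x₀ ∈ pM`
  have hx₀ : ((φ - 1) ^ d) x₀ ∈ (⊤ : Submodule ℤ M).map ((p : ℤ) • (1 : Module.End ℤ M)) := by
    have hwinv : (↑w⁻¹ : Module.End ℤ M) * (w : Module.End ℤ M) = 1 := by rw [← Units.val_mul, inv_mul_cancel, Units.val_one]
    have hcw : Commute ((φ - 1) ^ d) (w : Module.End ℤ M) := by rw [hw]; exact hcomm u
    have key : ((φ - 1) ^ d) x₀ = (↑w⁻¹ : Module.End ℤ M) (((φ - 1) ^ d) (aeval φ u x₀)) := by
      rw [← hw]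
      calc ((φ - 1) ^ d) x₀ = ((φ - 1) ^ d) ((↑w⁻¹ * ↑w : Module.End ℤ M) x₀) := by rw [hwinv, Module.End.one_apply]
        _ = ((φ - 1) ^ d * ↑w⁻¹) ((w : Module.End ℤ M) x₀) := by rw [Module.End.mul_apply, Module.End.mul_apply]
        _ = (↑w⁻¹ * (φ - 1) ^ d) ((w : Module.End ℤ M) x₀) := by rw [(hcw.units_inv_right).eq]
        _ = (↑w⁻¹ : Module.End ℤ M) (((φ - 1) ^ d) ((w : Module.End ℤ M) x₀)) := by rw [Module.End.mul_apply]
    rw [key]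
    exact apply_mem_map_top_smul _ hrel
  rintro _ ⟨y, rfl⟩
  obtain ⟨f, rfl⟩ := hgen y
  rw [← Module.End.mul_apply, (hcomm f).eq, Module.End.mul_apply]
  exact apply_mem_map_top_smul _ hx₀

/-- `#(M/f(M)) = #ker f` for an endomorphism `f` of a finite abelian group (`M/ker f ≅ f(M)`). [folklore] -/
private theorem card_quotient_range_eq_card_ker [Finite M] (f : Module.End ℤ M) :
    Nat.card (M ⧸ LinearMap.range f) = Nat.card (LinearMap.ker f) := by
  have h1 : Nat.card (LinearMap.ker f) * Nat.card (LinearMap.range f) = Nat.card M := by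
    rw [← Nat.card_congr (LinearMap.quotKerEquivRange f).toEquiv]
    exact (Submodule.card_eq_card_quotient_mul_card (LinearMap.ker f)).symm
  have h2 : Nat.card (LinearMap.range f) * Nat.card (M ⧸ LinearMap.range f) = Nat.card M :=
    (Submodule.card_eq_card_quotient_mul_card (LinearMap.range f)).symm
  have hpos : 0 < Nat.card (LinearMap.range f) := Nat.card_pos
  apply Nat.eq_of_mul_eq_mul_left hpos
  rw [h2, ← h1, mul_comm]

/-- ★★ **THE RELATION LEMMA.**  `M` a finite abelian `p`-group, `φ^{p^t} = 1`, `𝔪M = pM + (φ−1)M` of index `≤ p`, `x₀ ∉ 𝔪M`, `u ∈ ℤ[X]` with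
`p ∤ u(1)` and **`(φ−1)^d (u(φ) x₀) ∈ pM`**.  THEN **`#(M/pM) ≤ p^d`** (`x₀` generates; `(φ−1)^d M ⊆ pM`; the filtration count
`#(M/(T^dM + pM)) ≤ #(M/(TM + pM))^d`).  In `Λ`-terms: a relation of order `d` at `T = 0` modulo `p` on a generator of the cyclic module `A_n`
bounds `rank_p A_n ≤ d`. [cite: Washington1997, §13.3 Lemma 13.18 and Prop. 13.22–13.23] [cite: Fukuda1994, Thm. 1 (proof, p. 264)] -/
theorem card_quotient_smul_le_pow_of_relation [Finite M] [hp : Fact p.Prime] (hM : ∃ a : ℕ, Nat.card M = p ^ a) (φ : Module.End ℤ M)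
    {t : ℕ} (hφ : φ ^ p ^ t = 1)
    (hQ : Nat.card (M ⧸ ((⊤ : Submodule ℤ M).map ((p : ℤ) • (1 : Module.End ℤ M)) ⊔ (⊤ : Submodule ℤ M).map (φ - 1))) ≤ p)
    {x₀ : M} (hx₀ : x₀ ∉ (⊤ : Submodule ℤ M).map ((p : ℤ) • (1 : Module.End ℤ M)) ⊔ (⊤ : Submodule ℤ M).map (φ - 1))
    {u : ℤ[X]} (hu : ¬ (p : ℤ) ∣ u.eval 1) {d : ℕ}
    (hrel : ((φ - 1) ^ d) (aeval φ u x₀) ∈ (⊤ : Submodule ℤ M).map ((p : ℤ) • (1 : Module.End ℤ M))) :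
    Nat.card (M ⧸ (⊤ : Submodule ℤ M).map ((p : ℤ) • (1 : Module.End ℤ M))) ≤ p ^ d := by
  set P : Submodule ℤ M := (⊤ : Submodule ℤ M).map ((p : ℤ) • (1 : Module.End ℤ M)) with hP
  set T : Module.End ℤ M := φ - 1 with hT
  have hgen := forall_exists_aeval_apply_eq_of_not_mem hM φ hφ hQ hx₀
  have hle : LinearMap.range (T ^ d) ≤ P := range_pow_le_of_relation hM φ hφ hgen hu hrel
  have hPT : ∀ w ∈ P, T w ∈ P := fun w hw => apply_mem_map_top_smul T hw
  have h2 := card_quotient_range_pow_sup_le_pow T P hPT d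
  rw [sup_eq_right.mpr hle] at h2
  have h3 : Nat.card (M ⧸ (LinearMap.range T ⊔ P)) ≤ p := by
    have heq : LinearMap.range T ⊔ P = P ⊔ (⊤ : Submodule ℤ M).map T := by rw [← Submodule.map_top, sup_comm]
    rw [heq]; exact hQ
  exact h2.trans (Nat.pow_le_pow_left h3 d)

/-- ★★ **THE RELATION LEMMA, coefficient form.**  As `card_quotient_smul_le_pow_of_relation`, with the relation handed over as
**`∑_{i<N} f_i • φ^i x₀ = 0`** for a coefficient vector `f` together with the identity **`∑_{i<N} f_i X^i = (X−1)^d·u + p·g`** in `ℤ[X]` and `p ∤ u(1)`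
(then `(φ−1)^d u(φ) x₀ = −p·g(φ) x₀ ∈ pM`). [cite: Washington1997, §13.3 Prop. 13.22–13.23] [cite: Lang1990, Ch. 5 §2 (Weierstrass degree)] -/
theorem card_quotient_smul_le_pow_of_sum_smul_pow_apply_eq_zero [Finite M] [hp : Fact p.Prime] (hM : ∃ a : ℕ, Nat.card M = p ^ a)
    (φ : Module.End ℤ M) {t : ℕ} (hφ : φ ^ p ^ t = 1)
    (hQ : Nat.card (M ⧸ ((⊤ : Submodule ℤ M).map ((p : ℤ) • (1 : Module.End ℤ M)) ⊔ (⊤ : Submodule ℤ M).map (φ - 1))) ≤ p)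
    {x₀ : M} (hx₀ : x₀ ∉ (⊤ : Submodule ℤ M).map ((p : ℤ) • (1 : Module.End ℤ M)) ⊔ (⊤ : Submodule ℤ M).map (φ - 1))
    {N d : ℕ} {f : ℕ → ℤ} {u g : ℤ[X]} (hu : ¬ (p : ℤ) ∣ u.eval 1)
    (hF : (∑ i ∈ range N, C (f i) * X ^ i : ℤ[X]) = (X - 1) ^ d * u + C (p : ℤ) * g)
    (hrel : ∑ i ∈ range N, f i • (φ ^ i) x₀ = 0) :
    Nat.card (M ⧸ (⊤ : Submodule ℤ M).map ((p : ℤ) • (1 : Module.End ℤ M))) ≤ p ^ d := by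
  refine card_quotient_smul_le_pow_of_relation hM φ hφ hQ hx₀ hu (d := d) ?_
  -- evaluate the polynomial identity at `φ`, applied to `x₀`
  have hterm : ∀ i, aeval φ (C (f i) * X ^ i) x₀ = f i • (φ ^ i) x₀ := by
    intro i
    rw [map_mul, aeval_C, map_pow, aeval_X, algebraMap_int_eq, eq_intCast, Module.End.mul_apply, Module.End.intCast_apply]
  have hL : aeval φ (∑ i ∈ range N, C (f i) * X ^ i) x₀ = ∑ i ∈ range N, f i • (φ ^ i) x₀ := by
    rw [map_sum, LinearMap.sum_apply]
    exact Finset.sum_congr rfl fun i _ => hterm i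
  have hR : aeval φ ((X - 1) ^ d * u + C (p : ℤ) * g) x₀ = ((φ - 1) ^ d) (aeval φ u x₀) + (p : ℤ) • aeval φ g x₀ := by
    rw [map_add, map_mul, map_mul, map_pow, aeval_X_sub_one, aeval_C, algebraMap_int_eq, eq_intCast, LinearMap.add_apply,
      Module.End.mul_apply, Module.End.mul_apply, Module.End.intCast_apply]
  have h : ((φ - 1) ^ d) (aeval φ u x₀) + (p : ℤ) • aeval φ g x₀ = 0 := by rw [← hR, ← hF, hL, hrel]
  have h' : ((φ - 1) ^ d) (aeval φ u x₀) = -((p : ℤ) • aeval φ g x₀) := eq_neg_of_add_eq_zero_left h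
  rw [h']
  refine Submodule.neg_mem _ (Submodule.mem_map.mpr ⟨aeval φ g x₀, Submodule.mem_top, ?_⟩)
  rw [LinearMap.smul_apply, Module.End.one_apply]

end Module

end Literature.NumberTheory.IwasawaTheory.FukudaRelation

end
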